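import Mathlib
import Literature.MathematicalPhysics.QuantumFieldTheory.Sweep1
import Literature.MathematicalPhysics.QuantumFieldTheory.StrongCouplingActivities
import Literature.MathematicalPhysics.QuantumFieldTheory.Sweep1AreaLawProofs
import HarnessLib

/-!
# Sub-Gaussian concentration of the fundamental character on `U(N)`, uniformly in `N`

For a compact group `G` with a continuous faithful matrix model `ρ : G →* M_N(ℂ)` whose image is
exactly the unitary group (`IsUnitaryModel ρ`, i.e. `G ≅ U(N)`), the real part of the
fundamental character `f(g) = Re Tr ρ(g)` satisfies, for the normalised Haar measure and every
real `θ`,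

  `∫_G exp(θ f) dg ≤ exp(θ² / 2)`           (`plaqNorm_le_exp_sq_half`),

a bound which does **not** depend on `N` (whereas the trivial bound is `exp(|θ| N)`). As a
consequence the single-plaquette activity `e^{β f} - 1` of the strong-coupling expansion of
`U(N)` lattice gauge theory has all its Haar moments of order `β`, uniformly in `N`:

  `∫_G |exp(β f) - 1|^K dg ≤ 2 · K! · exp((K+1)²/2) · β^K`  for `0 ≤ β ≤ 1`
  (`integral_pow_abs_exp_sub_one_le`),

which is the `N`-uniform input of the proof of the Cao–Nissim–Sheffield area law
(`Sweep1.caoNissimSheffield_areaLaw`) by a Hölder-improved Osterwalder–Seiler expansion.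

## The argument (Herbst's argument for a Laplace eigenfunction; S. Chatterjee, *Concentration of
Haar measures, with an application to random matrices*, JFA 245 (2007) 379–389, Thm. 8, and
E. Meckes, *The Random Matrix Theory of the Classical Compact Groups*, CUP (2019), §5.2)

Only Haar invariance and one-variable calculus are used. For a skew-Hermitian matrix `Y` the
curve `t ↦ exp(tY)` runs in `U(N) = ρ(G)`, so by left invariance
`t ↦ ∫ H(exp(tY) ρ(g)) dg` is constant; differentiating under the integral at `t = 0` with
`H(M) = Re Tr(Y M) · e^{θ Re Tr M}` gives the integration-by-parts identity

  `∫ [Re Tr(Y Y ρg) + θ (Re Tr(Y ρg))²] e^{θ f} dg = 0`   (`integral_ibp_direction`).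

Summed over the `2N²` directions `Y^A_{jk} = E_{jk} - E_{kj}`, `Y^B_{jk} = i(E_{jk} + E_{kj})`
(`dirA`, `dirB`), the first terms add up to `-4N f` (the Casimir of the fundamental
representation: `Σ (Y^A)² + (Y^B)² = -4N·1`, `re_trace_dirA_dirA_add`) and the second to
`θ Γ` with `0 ≤ Γ ≤ 4N` for unitary arguments (`gammaSum_le`), whence
`m'(θ) = ∫ f e^{θf} ≤ θ m(θ)` for `θ ≥ 0` and `m(θ) ≤ e^{θ²/2}`; negative `θ` follow from the
central element `-1 ∈ U(N)` (`m(-θ) = m(θ)`).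

## Mathlib / tree anchors

`NormedSpace.exp_mem_unitary_of_mem_skewAdjoint`, `hasDerivAt_exp_smul_const'` (under
`open scoped Matrix.Norms.Operator`), `hasDerivAt_integral_of_dominated_loc_of_deriv_le`,
`MeasureTheory.integral_mul_left_eq_self`, `antitoneOn_of_deriv_nonpos`,
`Matrix.trace_single_mul`, `Real.pow_div_factorial_le_exp`; from the tree `plaqNorm`,
`continuous_trace_re` (`StrongCouplingActivities`), `haarProbability.instIsProbabilityMeasure`
(`GaugeGroups`), `AreaLaw.exp_sub_one_le_mul_exp` (`Sweep1AreaLawProofs`).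

## References

* S. Cao, R. Nissim, S. Sheffield, *Expanded regimes of area law for lattice Yang–Mills
  theories*, arXiv:2505.16585 (2025), Thm. 1.2. [arXiv250516585]
* S. Chatterjee, *Concentration of Haar measures, with an application to random matrices*,
  J. Funct. Anal. 245 (2007) 379–389.
* E. Meckes, *The Random Matrix Theory of the Classical Compact Groups*, Cambridge Tracts in
  Mathematics 218, CUP (2019), §5.2.
-/

open MeasureTheory Filter Topology Finset
open scoped Matrix ComplexConjugate

namespace Literature.MathematicalPhysics.QuantumFieldTheory

noncomputable section

/-! ## The gauge group: consequences of `IsUnitaryModel` -/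

section Model

variable {N : ℕ} {G : Type*} [Group G] [TopologicalSpace G] (ρ : G →* Matrix (Fin N) (Fin N) ℂ)

/-- For `G = U(N)` every `ρ(g)` is a unitary matrix. [folklore] -/
theorem IsUnitaryModel.mem_unitaryGroup (h : IsUnitaryModel ρ) (g : G) :
    ρ g ∈ Matrix.unitaryGroup (Fin N) ℂ := by
  have : ρ g ∈ Set.range ρ := Set.mem_range_self g
  rw [h.2.2] at this
  exact this

/-- For `G = U(N)` every unitary matrix is some `ρ(g)`. [folklore] -/
theorem IsUnitaryModel.exists_eq (h : IsUnitaryModel ρ) {V : Matrix (Fin N) (Fin N) ℂ}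
    (hV : V ∈ Matrix.unitaryGroup (Fin N) ℂ) : ∃ g : G, ρ g = V := by
  have : V ∈ Set.range ρ := by rw [h.2.2]; exact hV
  exact this

/-- For `G = U(N)` (a continuous faithful matrix model of a compact group) the group is second
countable, being embedded in a matrix space. [folklore] -/
theorem IsUnitaryModel.secondCountableTopology [CompactSpace G]
    (h : IsUnitaryModel ρ) : SecondCountableTopology G := by
  haveI : SecondCountableTopology (Matrix (Fin N) (Fin N) ℂ) :=
    show SecondCountableTopology (Fin N → Fin N → ℂ) from inferInstance
  haveI : T2Space (Matrix (Fin N) (Fin N) ℂ) := show T2Space (Fin N → Fin N → ℂ) from inferInstance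
  exact (h.1.isClosedEmbedding h.2.1).isEmbedding.secondCountableTopology

/-- **Centre of `U(N)`.** For `G = U(N)` there is a central `z ∈ G` with `ρ(z) = -1`.
[folklore] -/
theorem IsUnitaryModel.exists_central (h : IsUnitaryModel ρ) :
    ∃ z : G, ρ z = -1 ∧ ∀ g : G, g * z = z * g := by
  have hmem : (-1 : Matrix (Fin N) (Fin N) ℂ) ∈ Matrix.unitaryGroup (Fin N) ℂ := by
    rw [Matrix.mem_unitaryGroup_iff]; simp
  obtain ⟨z, hz⟩ := h.exists_eq ρ hmem
  refine ⟨z, hz, fun g => h.2.1 ?_⟩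
  rw [map_mul, map_mul, hz, mul_neg_one, neg_one_mul]

omit [TopologicalSpace G] in
/-- `Re Tr ρ(z g) = - Re Tr ρ(g)` for the central element with `ρ(z) = -1`. [folklore] -/
theorem trace_re_central_mul {z : G} (hz : ρ z = -1) (g : G) :
    (ρ (z * g)).trace.re = -(ρ g).trace.re := by
  rw [map_mul, hz, neg_one_mul, Matrix.trace_neg, Complex.neg_re]

end Model

/-! ## The `2N²` skew-Hermitian directions and the Casimir identity -/

section Directions

variable {N : ℕ}

/-- The direction `Y^A_{jk} = E_{jk} - E_{kj}` (a real antisymmetric matrix unit). [folklore] -/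
def dirA (j k : Fin N) : Matrix (Fin N) (Fin N) ℂ := Matrix.single j k 1 - Matrix.single k j 1

/-- The direction `Y^B_{jk} = i (E_{jk} + E_{kj})` (an imaginary symmetric matrix unit). [folklore] -/
def dirB (j k : Fin N) : Matrix (Fin N) (Fin N) ℂ :=
  Complex.I • (Matrix.single j k 1 + Matrix.single k j 1)

/-- `Y^A` is skew-Hermitian. [folklore] -/
theorem dirA_conjTranspose (j k : Fin N) : (dirA j k)ᴴ = -dirA j k := by
  simp [dirA, Matrix.conjTranspose_sub, Matrix.conjTranspose_single]

/-- `Y^B` is skew-Hermitian. [folklore] -/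
theorem dirB_conjTranspose (j k : Fin N) : (dirB j k)ᴴ = -dirB j k := by
  simp only [dirB, Matrix.conjTranspose_smul, Matrix.conjTranspose_add,
    Matrix.conjTranspose_single, star_one, Complex.star_def, Complex.conj_I, neg_smul]
  rw [add_comm]

/-- `Tr(E_{ab} (E_{ce} M)) = [b = c] M_{ea}`. [folklore] -/
theorem trace_single_mul_single_mul (a b c e : Fin N) (M : Matrix (Fin N) (Fin N) ℂ) :
    (Matrix.single a b (1 : ℂ) * (Matrix.single c e (1 : ℂ) * M)).trace =
      if b = c then M e a else 0 := by
  rw [Matrix.trace_single_mul, one_smul]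
  split_ifs with h
  · subst h; rw [Matrix.single_mul_apply_same, one_mul]
  · rw [Matrix.single_mul_apply_of_ne _ _ _ _ _ h]

/-- `Re Tr(Y^A_{jk} M) = Re (M_{kj} - M_{jk})`. [folklore] -/
theorem re_trace_dirA_mul (j k : Fin N) (M : Matrix (Fin N) (Fin N) ℂ) :
    (dirA j k * M).trace.re = (M k j - M j k).re := by
  simp only [dirA, sub_mul, Matrix.trace_sub, Matrix.trace_single_mul, one_smul]

/-- `Re Tr(Y^B_{jk} M) = - Im (M_{kj} + M_{jk})`. [folklore] -/
theorem re_trace_dirB_mul (j k : Fin N) (M : Matrix (Fin N) (Fin N) ℂ) :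
    (dirB j k * M).trace.re = -(M k j + M j k).im := by
  simp only [dirB, smul_mul_assoc, add_mul, Matrix.trace_smul, Matrix.trace_add,
    Matrix.trace_single_mul, smul_eq_mul, Complex.mul_re, Complex.I_re, Complex.I_im,
    zero_mul, one_mul, zero_sub]

/-- **Casimir, one pair of directions**:
`Re Tr(Y^A (Y^A M)) + Re Tr(Y^B (Y^B M)) = -2 Re (M_{jj} + M_{kk})` (the `δ_{jk}`-terms of the two
types cancel). [folklore] -/
theorem re_trace_dirA_dirA_add (j k : Fin N) (M : Matrix (Fin N) (Fin N) ℂ) :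
    (dirA j k * (dirA j k * M)).trace.re + (dirB j k * (dirB j k * M)).trace.re =
      -2 * (M j j + M k k).re := by
  have hA : (dirA j k * (dirA j k * M)).trace =
      (Matrix.single j k (1 : ℂ) * (Matrix.single j k (1 : ℂ) * M)).trace -
        (Matrix.single j k (1 : ℂ) * (Matrix.single k j (1 : ℂ) * M)).trace -
        (Matrix.single k j (1 : ℂ) * (Matrix.single j k (1 : ℂ) * M)).trace +
        (Matrix.single k j (1 : ℂ) * (Matrix.single k j (1 : ℂ) * M)).trace := by
    simp only [dirA, sub_mul, mul_sub, Matrix.trace_sub]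
    ring
  have hB : (dirB j k * (dirB j k * M)).trace =
      -((Matrix.single j k (1 : ℂ) * (Matrix.single j k (1 : ℂ) * M)).trace +
        (Matrix.single j k (1 : ℂ) * (Matrix.single k j (1 : ℂ) * M)).trace +
        (Matrix.single k j (1 : ℂ) * (Matrix.single j k (1 : ℂ) * M)).trace +
        (Matrix.single k j (1 : ℂ) * (Matrix.single k j (1 : ℂ) * M)).trace) := by
    have h1 : dirB j k * (dirB j k * M) =
        -((Matrix.single j k 1 + Matrix.single k j 1) *
          ((Matrix.single j k 1 + Matrix.single k j 1) * M)) := by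
      simp only [dirB, smul_mul_assoc, mul_smul_comm, smul_smul, Complex.I_mul_I, neg_smul,
        one_smul]
    rw [h1, Matrix.trace_neg]
    simp only [add_mul, mul_add, Matrix.trace_add]
    ring
  rw [← Complex.add_re, hA, hB]
  simp only [trace_single_mul_single_mul, if_true]
  by_cases hjk : j = k
  · subst hjk
    simp only [if_true, Complex.add_re, Complex.sub_re, Complex.neg_re]
    ring
  · have hkj : ¬ k = j := fun h => hjk h.symm
    simp only [hjk, hkj, if_false, Complex.add_re, Complex.sub_re, Complex.neg_re,
      Complex.zero_re]
    ring

/-- **The carré du champ of one pair of directions is dominated by the entries**: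
`(Re Tr(Y^A M))² + (Re Tr(Y^B M))² ≤ 2 (|M_{kj}|² + |M_{jk}|²)`. [folklore] -/
theorem sq_re_trace_dirA_add_le (j k : Fin N) (M : Matrix (Fin N) (Fin N) ℂ) :
    (dirA j k * M).trace.re ^ 2 + (dirB j k * M).trace.re ^ 2 ≤
      2 * (Complex.normSq (M k j) + Complex.normSq (M j k)) := by
  rw [re_trace_dirA_mul, re_trace_dirB_mul, Complex.sub_re, Complex.add_im, Complex.normSq_apply,
    Complex.normSq_apply]
  nlinarith [sq_nonneg ((M k j).re + (M j k).re), sq_nonneg ((M k j).im - (M j k).im)]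

/-- **Row sums of a unitary matrix**: `Σ_k |U_{jk}|² = 1`. [folklore] -/
theorem sum_normSq_row_eq_one {U : Matrix (Fin N) (Fin N) ℂ}
    (hU : U ∈ Matrix.unitaryGroup (Fin N) ℂ) (j : Fin N) :
    ∑ k, Complex.normSq (U j k) = 1 := by
  have h := Matrix.mem_unitaryGroup_iff.1 hU
  have hjj := congrFun (congrFun h j) j
  rw [Matrix.mul_apply, Matrix.one_apply_eq] at hjj
  have : (∑ k, (Complex.normSq (U j k) : ℂ)) = 1 := by
    rw [← hjj]
    refine Finset.sum_congr rfl fun k _ => ?_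
    rw [Matrix.star_apply, Complex.star_def, Complex.mul_conj]
  exact_mod_cast this

/-- `Σ_{j,k} |U_{jk}|² = N` for a unitary `N × N` matrix. [folklore] -/
theorem sum_sum_normSq_eq {U : Matrix (Fin N) (Fin N) ℂ}
    (hU : U ∈ Matrix.unitaryGroup (Fin N) ℂ) :
    ∑ j, ∑ k, Complex.normSq (U j k) = N := by
  simp [sum_normSq_row_eq_one hU]

/-- The summed carré du champ `Γ(M) = Σ_{j,k} (Re Tr(Y^A_{jk} M))² + (Re Tr(Y^B_{jk} M))²`. [folklore] -/
def gammaSum (M : Matrix (Fin N) (Fin N) ℂ) : ℝ :=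
  ∑ j, ∑ k, ((dirA j k * M).trace.re ^ 2 + (dirB j k * M).trace.re ^ 2)

/-- `Γ ≥ 0`. [folklore] -/
theorem gammaSum_nonneg (M : Matrix (Fin N) (Fin N) ℂ) : 0 ≤ gammaSum M :=
  Finset.sum_nonneg fun _ _ => Finset.sum_nonneg fun _ _ => by positivity

/-- `Γ(U) ≤ 4N` for unitary `U` (Bessel's inequality for the orthogonal system of directions).
[folklore] -/
theorem gammaSum_le {U : Matrix (Fin N) (Fin N) ℂ} (hU : U ∈ Matrix.unitaryGroup (Fin N) ℂ) :
    gammaSum U ≤ 4 * N := by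
  calc gammaSum U ≤ ∑ j, ∑ k, 2 * (Complex.normSq (U k j) + Complex.normSq (U j k)) :=
        Finset.sum_le_sum fun j _ => Finset.sum_le_sum fun k _ => sq_re_trace_dirA_add_le j k U
    _ = 2 * (∑ j, ∑ k, Complex.normSq (U k j)) + 2 * ∑ j, ∑ k, Complex.normSq (U j k) := by
        simp only [mul_add, Finset.sum_add_distrib, Finset.mul_sum]
    _ = 2 * N + 2 * N := by
        rw [Finset.sum_comm, sum_sum_normSq_eq hU]
    _ = 4 * N := by ring

/-- **Casimir of the fundamental representation**, summed form:
`Σ_{j,k} [Re Tr(Y^A(Y^A M)) + Re Tr(Y^B(Y^B M))] = -4N Re Tr M`. [folklore] -/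
theorem sum_re_trace_dir_dir (M : Matrix (Fin N) (Fin N) ℂ) :
    ∑ j, ∑ k, ((dirA j k * (dirA j k * M)).trace.re + (dirB j k * (dirB j k * M)).trace.re) =
      -4 * N * M.trace.re := by
  simp_rw [re_trace_dirA_dirA_add, Complex.add_re, mul_add, Finset.sum_add_distrib,
    Finset.sum_const, Finset.card_univ, Fintype.card_fin, nsmul_eq_mul]
  rw [Matrix.trace, Complex.re_sum]
  simp only [Matrix.diag_apply, Finset.mul_sum, ← Finset.sum_add_distrib]
  exact Finset.sum_congr rfl fun j _ => by ring

end Directions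

/-! ## Integration by parts along one-parameter subgroups of `U(N)` -/

section IBP

variable {N : ℕ} {G : Type*} [Group G] [TopologicalSpace G] [IsTopologicalGroup G]
  [CompactSpace G] [MeasurableSpace G] [BorelSpace G] (ρ : G →* Matrix (Fin N) (Fin N) ℂ)

/-- `exp(t Y)` is unitary for skew-Hermitian `Y` and real `t`. [folklore] -/
theorem exp_smul_mem_unitaryGroup {Y : Matrix (Fin N) (Fin N) ℂ} (hY : Yᴴ = -Y) (t : ℝ) :
    NormedSpace.exp (t • Y) ∈ Matrix.unitaryGroup (Fin N) ℂ := by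
  rw [Matrix.mem_unitaryGroup_iff, Matrix.star_eq_conjTranspose, ← Matrix.exp_conjTranspose,
    Matrix.conjTranspose_smul, hY, star_trivial, smul_neg, ← Matrix.exp_add_of_commute,
    add_neg_cancel, NormedSpace.exp_zero]
  exact (Commute.refl _).neg_right

/-- `t ↦ exp(tY)` is continuous (for the entrywise topology). [folklore] -/
theorem continuous_exp_smul (Y : Matrix (Fin N) (Fin N) ℂ) :
    Continuous fun t : ℝ => NormedSpace.exp (t • Y) := by
  open scoped Matrix.Norms.Operator in
  exact NormedSpace.exp_continuous.comp (continuous_id.smul continuous_const)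

/-- The real-linear functional `M ↦ Re Tr(A M)` as a continuous linear map. [folklore] -/
def reTraceMulCLM (A : Matrix (Fin N) (Fin N) ℂ) : Matrix (Fin N) (Fin N) ℂ →L[ℝ] ℝ :=
  LinearMap.toContinuousLinearMap
    { toFun := fun M => (A * M).trace.re
      map_add' := fun M M' => by rw [mul_add, Matrix.trace_add, Complex.add_re]
      map_smul' := fun c M => by
        rw [Matrix.mul_smul, Matrix.trace_smul, RingHom.id_apply, Complex.real_smul,
          Complex.re_ofReal_mul, smul_eq_mul] }

/-- Evaluation of `reTraceMulCLM`. [folklore] -/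
@[simp]
theorem reTraceMulCLM_apply (A M : Matrix (Fin N) (Fin N) ℂ) :
    reTraceMulCLM A M = (A * M).trace.re := rfl

/-- Derivative of `t ↦ Re Tr(A exp(tY) M)`: `Re Tr(A Y exp(tY) M)`. [folklore] -/
theorem hasDerivAt_re_trace_mul_exp (A Y M : Matrix (Fin N) (Fin N) ℂ) (t : ℝ) :
    HasDerivAt (fun s : ℝ => (A * (NormedSpace.exp (s • Y) * M)).trace.re)
      ((A * (Y * NormedSpace.exp (t • Y) * M)).trace.re) t := by
  open scoped Matrix.Norms.Operator in
  have h1 : HasDerivAt (fun s : ℝ => NormedSpace.exp (s • Y) * M)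
      (Y * NormedSpace.exp (t • Y) * M) t :=
    (hasDerivAt_exp_smul_const' (𝕂 := ℝ) Y t).mul_const M
  open scoped Matrix.Norms.Operator in
  have h2 : HasDerivAt (fun s : ℝ => reTraceMulCLM A (NormedSpace.exp (s • Y) * M))
      (reTraceMulCLM A (Y * NormedSpace.exp (t • Y) * M)) t :=
    (reTraceMulCLM A).hasFDerivAt.comp_hasDerivAt t h1
  exact h2

omit [IsTopologicalGroup G] [CompactSpace G] [MeasurableSpace G] [BorelSpace G] [Group G]
  [TopologicalSpace G] in
/-- `x ↦ Re Tr A(x)` is continuous for a continuous matrix-valued map `A`. [folklore] -/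
theorem continuous_trace_re_of {X : Type*} [TopologicalSpace X] {A : X → Matrix (Fin N) (Fin N) ℂ}
    (hA : Continuous A) : Continuous fun x => (A x).trace.re :=
  Complex.continuous_re.comp hA.matrix_trace

/-- **Integration by parts along a one-parameter subgroup.** For `G = U(N)`, a skew-Hermitian
direction `Y` and real `θ`, with `f = Re Tr ρ`:
`∫ [Re Tr(Y Y ρg) + θ (Re Tr(Y ρg))²] e^{θ f(g)} dg = 0` — left invariance of Haar measure
under `g ↦ ρ⁻¹(exp tY) g`, differentiated at `t = 0` under the integral sign. [folklore] -/
theorem integral_ibp_direction (hρ : IsUnitaryModel ρ) {Y : Matrix (Fin N) (Fin N) ℂ}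
    (hY : Yᴴ = -Y) (θ : ℝ) :
    ∫ g, ((Y * (Y * ρ g)).trace.re + θ * (Y * ρ g).trace.re ^ 2) *
        Real.exp (θ * (ρ g).trace.re) ∂haarProbability G = 0 := by
  set μ := haarProbability G
  have hρc : Continuous ρ := hρ.1
  -- the one-parameter subgroup and its lift to `G`
  set u : ℝ → Matrix (Fin N) (Fin N) ℂ := fun t => NormedSpace.exp (t • Y) with hu
  have hu_cont : Continuous u := continuous_exp_smul Y
  have hu0 : u 0 = 1 := by simp [hu]
  have hlift : ∀ t, ∃ γ : G, ρ γ = u t := fun t => hρ.exists_eq ρ (exp_smul_mem_unitaryGroup hY t)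
  choose γ hγ using hlift
  -- the integrand and its `t`-derivative
  set F : ℝ → G → ℝ := fun t g =>
    (Y * (u t * ρ g)).trace.re * Real.exp (θ * (u t * ρ g).trace.re) with hF
  set F' : ℝ → G → ℝ := fun t g =>
    ((Y * (Y * u t * ρ g)).trace.re + θ * (Y * u t * ρ g).trace.re ^ 2) *
      Real.exp (θ * (u t * ρ g).trace.re) with hF'
  -- `F t` is a left translate of `F 0`, so its integral is constant
  have hconst : ∀ t, ∫ g, F t g ∂μ = ∫ g, F 0 g ∂μ := by
    intro t
    have h1 : ∀ g, F t g = F 0 (γ t * g) := by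
      intro g
      simp only [hF, hu0, one_mul, map_mul, hγ]
    simp_rw [h1]
    exact integral_mul_left_eq_self (fun g => F 0 g) (γ t)
  -- continuity in `g` for fixed `t`, and in `(t, g)` jointly for the derivative
  have hFt_cont : ∀ t, Continuous (F t) := by
    intro t
    have hc1 : Continuous fun g : G => u t * ρ g := continuous_const.mul hρc
    exact (continuous_trace_re_of (continuous_const.mul hc1)).mul
      (Real.continuous_exp.comp (continuous_const.mul (continuous_trace_re_of hc1)))
  have hF't_cont : ∀ t, Continuous (F' t) := by
    intro t
    have hc1 : Continuous fun g : G => u t * ρ g := continuous_const.mul hρc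
    have hc2 : Continuous fun g : G => Y * u t * ρ g := continuous_const.mul hρc
    exact ((continuous_trace_re_of (continuous_const.mul hc2)).add (continuous_const.mul ((continuous_trace_re_of hc2).pow 2))).mul
      (Real.continuous_exp.comp (continuous_const.mul (continuous_trace_re_of hc1)))
  have hF'_cont : Continuous fun p : ℝ × G => F' p.1 p.2 := by
    have hc1 : Continuous fun p : ℝ × G => u p.1 * ρ p.2 :=
      (hu_cont.comp continuous_fst).mul (hρc.comp continuous_snd)
    have hc2 : Continuous fun p : ℝ × G => Y * u p.1 * ρ p.2 :=
      (continuous_const.mul (hu_cont.comp continuous_fst)).mul (hρc.comp continuous_snd)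
    exact ((continuous_trace_re_of (continuous_const.mul hc2)).add (continuous_const.mul ((continuous_trace_re_of hc2).pow 2))).mul
      (Real.continuous_exp.comp (continuous_const.mul (continuous_trace_re_of hc1)))
  have hint : ∀ {φ : G → ℝ}, Continuous φ → Integrable φ μ := fun hφ =>
    hφ.integrable_of_hasCompactSupport (HasCompactSupport.of_compactSpace _)
  -- a uniform bound for `F'` on `[-1, 1] × G` by compactness
  obtain ⟨C, hC⟩ : ∃ C, ∀ p ∈ (Metric.closedBall (0 : ℝ) 1) ×ˢ (Set.univ : Set G),
      ‖F' p.1 p.2‖ ≤ C :=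
    ((isCompact_closedBall (0 : ℝ) 1).prod isCompact_univ).exists_bound_of_continuousOn
      hF'_cont.continuousOn
  -- pointwise derivative
  have hderiv : ∀ g t, HasDerivAt (fun s => F s g) (F' t g) t := by
    intro g t
    have h3 := hasDerivAt_re_trace_mul_exp Y Y (ρ g) t
    have h4 := hasDerivAt_re_trace_mul_exp 1 Y (ρ g) t
    simp only [one_mul] at h4
    have h5 := (h4.const_mul θ).exp
    have h6 := h3.mul h5
    have : F' t g = (Y * (Y * NormedSpace.exp (t • Y) * ρ g)).trace.re *
        Real.exp (θ * (NormedSpace.exp (t • Y) * ρ g).trace.re) +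
        (Y * (NormedSpace.exp (t • Y) * ρ g)).trace.re *
          (Real.exp (θ * (NormedSpace.exp (t • Y) * ρ g).trace.re) *
            (θ * (Y * NormedSpace.exp (t • Y) * ρ g).trace.re)) := by
      simp only [hF', hu, Matrix.mul_assoc]
      ring
    rw [this]
    exact h6
  -- differentiate under the integral sign at `t = 0`
  have hmain := hasDerivAt_integral_of_dominated_loc_of_deriv_le (μ := μ) (F := F) (F' := F')
    (x₀ := (0 : ℝ)) (s := Metric.ball 0 1) (bound := fun _ => C) (Metric.ball_mem_nhds 0 one_pos)
    (Eventually.of_forall fun t => (hFt_cont t).aestronglyMeasurable) (hint (hFt_cont 0))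
    (hF't_cont 0).aestronglyMeasurable
    (ae_of_all _ fun g t ht => hC (t, g)
      ⟨Metric.ball_subset_closedBall ht, Set.mem_univ _⟩)
    (integrable_const C) (ae_of_all _ fun g t _ => hderiv g t)
  have hzero : HasDerivAt (fun t => ∫ g, F t g ∂μ) 0 0 := by
    have : (fun t => ∫ g, F t g ∂μ) = fun _ => ∫ g, F 0 g ∂μ := funext hconst
    rw [this]
    exact hasDerivAt_const _ _
  have heq : ∫ g, F' 0 g ∂μ = 0 := hmain.2.unique hzero
  simpa [hF', hu0] using heq

end IBP

/-! ## The sub-Gaussian bound for `Re Tr` on `U(N)` -/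

section SubGaussian

variable {N : ℕ} {G : Type*} [Group G] [TopologicalSpace G] [IsTopologicalGroup G]
  [CompactSpace G] [MeasurableSpace G] [BorelSpace G] (ρ : G →* Matrix (Fin N) (Fin N) ℂ)

/-- Continuous functions on the compact group are Haar integrable. [folklore] -/
theorem integrable_haar_of_continuous {φ : G → ℝ} (hφ : Continuous φ) :
    Integrable φ (haarProbability G) :=
  hφ.integrable_of_hasCompactSupport (HasCompactSupport.of_compactSpace _)

/-- **The differential inequality.** For `G = U(N)`, `N ≥ 1` and `θ ≥ 0`:
`∫ f e^{θ f} ≤ θ ∫ e^{θ f}` with `f = Re Tr ρ` (Casimir identity summed over the `2N²`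
directions, and `Γ ≤ 4N`). [folklore] -/
theorem integral_trace_re_mul_exp_le (hρ : IsUnitaryModel ρ) (hN : 1 ≤ N) {θ : ℝ} (hθ : 0 ≤ θ) :
    ∫ g, (ρ g).trace.re * Real.exp (θ * (ρ g).trace.re) ∂haarProbability G ≤
      θ * ∫ g, Real.exp (θ * (ρ g).trace.re) ∂haarProbability G := by
  set μ := haarProbability G
  have hρc : Continuous ρ := hρ.1
  have hu := hρ.mem_unitaryGroup ρ
  set f : G → ℝ := fun g => (ρ g).trace.re with hf
  have hfc : Continuous f := continuous_trace_re ρ hρc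
  have hec : Continuous fun g => Real.exp (θ * f g) := Real.continuous_exp.comp (continuous_const.mul hfc)
  -- sum the integration-by-parts identities over all directions
  have hA : ∀ j k : Fin N, ∫ g, ((dirA j k * (dirA j k * ρ g)).trace.re +
      θ * (dirA j k * ρ g).trace.re ^ 2) * Real.exp (θ * f g) ∂μ = 0 :=
    fun j k => integral_ibp_direction ρ hρ (dirA_conjTranspose j k) θ
  have hB : ∀ j k : Fin N, ∫ g, ((dirB j k * (dirB j k * ρ g)).trace.re +
      θ * (dirB j k * ρ g).trace.re ^ 2) * Real.exp (θ * f g) ∂μ = 0 :=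
    fun j k => integral_ibp_direction ρ hρ (dirB_conjTranspose j k) θ
  have hcontY : ∀ Y : Matrix (Fin N) (Fin N) ℂ, Continuous fun g =>
      ((Y * (Y * ρ g)).trace.re + θ * (Y * ρ g).trace.re ^ 2) * Real.exp (θ * f g) := by
    intro Y
    refine Continuous.mul (Continuous.add ?_ ?_) hec
    · exact Complex.continuous_re.comp
        ((continuous_const.mul (continuous_const.mul hρc)).matrix_trace)
    · exact continuous_const.mul
        ((Complex.continuous_re.comp ((continuous_const.mul hρc).matrix_trace)).pow 2)
  have hsum : ∫ g, ∑ j, ∑ k, (((dirA j k * (dirA j k * ρ g)).trace.re +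
      θ * (dirA j k * ρ g).trace.re ^ 2) * Real.exp (θ * f g) +
      ((dirB j k * (dirB j k * ρ g)).trace.re +
      θ * (dirB j k * ρ g).trace.re ^ 2) * Real.exp (θ * f g)) ∂μ = 0 := by
    rw [integral_finsetSum _ fun j _ => ?_]
    · refine Finset.sum_eq_zero fun j _ => ?_
      rw [integral_finsetSum _ fun k _ => ?_]
      · refine Finset.sum_eq_zero fun k _ => ?_
        rw [integral_add (integrable_haar_of_continuous (hcontY _))
          (integrable_haar_of_continuous (hcontY _)), hA, hB, add_zero]
      · exact (integrable_haar_of_continuous (hcontY _)).add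
          (integrable_haar_of_continuous (hcontY _))
    · exact integrable_finsetSum _ fun k _ =>
        (integrable_haar_of_continuous (hcontY _)).add (integrable_haar_of_continuous (hcontY _))
  -- pointwise, the summed integrand is `(-4N f + θ Γ) e^{θ f}`
  have hpt : ∀ g, ∑ j, ∑ k, (((dirA j k * (dirA j k * ρ g)).trace.re +
      θ * (dirA j k * ρ g).trace.re ^ 2) * Real.exp (θ * f g) +
      ((dirB j k * (dirB j k * ρ g)).trace.re +
      θ * (dirB j k * ρ g).trace.re ^ 2) * Real.exp (θ * f g)) =
      (-4 * N * f g + θ * gammaSum (ρ g)) * Real.exp (θ * f g) := by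
    intro g
    rw [← sum_re_trace_dir_dir (ρ g), gammaSum, Finset.mul_sum, ← Finset.sum_add_distrib,
      Finset.sum_mul]
    refine Finset.sum_congr rfl fun j _ => ?_
    rw [Finset.mul_sum, ← Finset.sum_add_distrib, Finset.sum_mul]
    refine Finset.sum_congr rfl fun k _ => ?_
    ring
  simp_rw [hpt] at hsum
  -- hence `4N ∫ f e^{θf} = θ ∫ Γ e^{θf} ≤ 4N θ ∫ e^{θf}`
  have hΓc : Continuous fun g => gammaSum (ρ g) := by
    unfold gammaSum
    refine continuous_finsetSum _ fun j _ => continuous_finsetSum _ fun k _ => ?_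
    exact ((Complex.continuous_re.comp ((continuous_const.mul hρc).matrix_trace)).pow 2).add
      ((Complex.continuous_re.comp ((continuous_const.mul hρc).matrix_trace)).pow 2)
  have hi1 : Integrable (fun g => f g * Real.exp (θ * f g)) μ :=
    integrable_haar_of_continuous (hfc.mul hec)
  have hi2 : Integrable (fun g => gammaSum (ρ g) * Real.exp (θ * f g)) μ :=
    integrable_haar_of_continuous (hΓc.mul hec)
  have hi3 : Integrable (fun g => Real.exp (θ * f g)) μ := integrable_haar_of_continuous hec
  have hsplit : ∫ g, (-4 * N * f g + θ * gammaSum (ρ g)) * Real.exp (θ * f g) ∂μ =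
      -4 * N * ∫ g, f g * Real.exp (θ * f g) ∂μ +
        θ * ∫ g, gammaSum (ρ g) * Real.exp (θ * f g) ∂μ := by
    have : ∀ g, (-4 * N * f g + θ * gammaSum (ρ g)) * Real.exp (θ * f g) =
        -4 * N * (f g * Real.exp (θ * f g)) + θ * (gammaSum (ρ g) * Real.exp (θ * f g)) := by
      intro g; ring
    simp_rw [this]
    rw [integral_add (hi1.const_mul _) (hi2.const_mul _), integral_const_mul, integral_const_mul]
  rw [hsplit] at hsum
  have hΓint : ∫ g, gammaSum (ρ g) * Real.exp (θ * f g) ∂μ ≤ 4 * N * ∫ g, Real.exp (θ * f g) ∂μ := by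
    rw [← integral_const_mul]
    refine integral_mono hi2 (hi3.const_mul _) fun g => ?_
    exact mul_le_mul_of_nonneg_right (gammaSum_le (hu g)) (Real.exp_pos _).le
  have hN' : (0 : ℝ) < 4 * N := by positivity
  have key : 4 * N * ∫ g, f g * Real.exp (θ * f g) ∂μ ≤ 4 * N * (θ * ∫ g, Real.exp (θ * f g) ∂μ) := by
    calc 4 * N * ∫ g, f g * Real.exp (θ * f g) ∂μ
        = θ * ∫ g, gammaSum (ρ g) * Real.exp (θ * f g) ∂μ := by linarith
      _ ≤ θ * (4 * N * ∫ g, Real.exp (θ * f g) ∂μ) := mul_le_mul_of_nonneg_left hΓint hθ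
      _ = 4 * N * (θ * ∫ g, Real.exp (θ * f g) ∂μ) := by ring
  exact le_of_mul_le_mul_left key hN'

/-- The single-plaquette Boltzmann integral is differentiable in the coupling, with
`d/dθ ∫ e^{θ f} = ∫ f e^{θ f}`. [folklore] -/
theorem hasDerivAt_plaqNorm (hρc : Continuous ρ) (θ : ℝ) :
    HasDerivAt (fun s => plaqNorm ρ s (G := G))
      (∫ g, (ρ g).trace.re * Real.exp (θ * (ρ g).trace.re) ∂haarProbability G) θ := by
  set μ := haarProbability G
  set f : G → ℝ := fun g => (ρ g).trace.re with hf
  have hfc : Continuous f := continuous_trace_re ρ hρc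
  obtain ⟨B, hB0, hB⟩ := exists_bound_trace_re_nonneg ρ hρc (G := G)
  set F : ℝ → G → ℝ := fun s g => Real.exp (s * f g)
  set F' : ℝ → G → ℝ := fun s g => f g * Real.exp (s * f g)
  have hFc : ∀ s, Continuous (F s) := fun s => Real.continuous_exp.comp (continuous_const.mul hfc)
  have hF'c : ∀ s, Continuous (F' s) := fun s => hfc.mul (hFc s)
  have hmain := hasDerivAt_integral_of_dominated_loc_of_deriv_le (μ := μ) (F := F) (F' := F')
    (x₀ := θ) (s := Metric.ball θ 1) (bound := fun _ => B * Real.exp ((|θ| + 1) * B))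
    (Metric.ball_mem_nhds θ one_pos)
    (Eventually.of_forall fun s => (hFc s).aestronglyMeasurable)
    (integrable_haar_of_continuous (hFc θ)) (hF'c θ).aestronglyMeasurable
    (ae_of_all _ fun g s hs => ?_) (integrable_const _)
    (ae_of_all _ fun g s _ => ?_)
  · exact hmain.2
  · -- the bound on the derivative
    have hs' : |s| ≤ |θ| + 1 := by
      have := Metric.mem_ball.1 hs
      rw [Real.dist_eq] at this
      have := abs_sub_abs_le_abs_sub s θ
      linarith
    rw [Real.norm_eq_abs, abs_mul, Real.abs_exp]
    refine mul_le_mul (hB g) (Real.exp_le_exp.2 ?_) (Real.exp_pos _).le hB0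
    calc s * f g ≤ |s * f g| := le_abs_self _
      _ = |s| * |f g| := abs_mul _ _
      _ ≤ (|θ| + 1) * B := mul_le_mul hs' (hB g) (abs_nonneg _) (by positivity)
  · -- the pointwise derivative
    have h := ((hasDerivAt_id s).mul_const (f g)).exp
    simp only [id, one_mul] at h
    simpa [F', mul_comm] using h

/-- `∫ e^{θ f} = 1` at `θ = 0`. [folklore] -/
theorem plaqNorm_zero : plaqNorm ρ 0 (G := G) = 1 := by
  simp [plaqNorm]

/-- **Sub-Gaussian bound, `θ ≥ 0`.** For `G = U(N)`: `∫ e^{θ Re Tr ρ} ≤ e^{θ²/2}`. [folklore] -/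
theorem plaqNorm_le_exp_sq_half_of_nonneg (hρ : IsUnitaryModel ρ) {θ : ℝ} (hθ : 0 ≤ θ) :
    plaqNorm ρ θ (G := G) ≤ Real.exp (θ ^ 2 / 2) := by
  have hρc : Continuous ρ := hρ.1
  rcases Nat.lt_or_ge N 1 with hN | hN
  · -- `N = 0`: the trace vanishes identically
    have hN0 : N = 0 := by omega
    subst hN0
    have : plaqNorm ρ θ (G := G) = 1 := by
      simp [plaqNorm, Matrix.trace]
    rw [this]
    exact Real.one_le_exp (by positivity)
  -- `g(s) = m(s) e^{-s²/2}` is non-increasing on `[0, ∞)`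
  set m : ℝ → ℝ := fun s => plaqNorm ρ s (G := G) with hm
  set ψ : ℝ → ℝ := fun s => m s * Real.exp (-(s ^ 2 / 2)) with hψ
  have hmd : ∀ s, HasDerivAt m
      (∫ g, (ρ g).trace.re * Real.exp (s * (ρ g).trace.re) ∂haarProbability G) s :=
    fun s => hasDerivAt_plaqNorm ρ hρc s
  have hed : ∀ s, HasDerivAt (fun s : ℝ => Real.exp (-(s ^ 2 / 2))) (Real.exp (-(s ^ 2 / 2)) * (-s)) s := by
    intro s
    have h1 : HasDerivAt (fun s : ℝ => -(s ^ 2 / 2)) (-s) s :=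
      ((hasDerivAt_pow 2 s).div_const 2).neg.congr_deriv (by norm_num)
    exact h1.exp
  have hψd : ∀ s, HasDerivAt ψ
      ((∫ g, (ρ g).trace.re * Real.exp (s * (ρ g).trace.re) ∂haarProbability G) *
          Real.exp (-(s ^ 2 / 2)) + m s * (Real.exp (-(s ^ 2 / 2)) * (-s))) s :=
    fun s => (hmd s).mul (hed s)
  have hanti : AntitoneOn ψ (Set.Ici 0) := by
    refine antitoneOn_of_deriv_nonpos (convex_Ici 0)
      (fun s _ => (hψd s).continuousAt.continuousWithinAt)
      (fun s _ => (hψd s).differentiableAt.differentiableWithinAt) fun s hs => ?_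
    rw [interior_Ici] at hs
    rw [(hψd s).deriv]
    have hle := integral_trace_re_mul_exp_le ρ hρ hN (le_of_lt hs)
    have hpos : 0 < Real.exp (-(s ^ 2 / 2)) := Real.exp_pos _
    have : (∫ g, (ρ g).trace.re * Real.exp (s * (ρ g).trace.re) ∂haarProbability G) *
        Real.exp (-(s ^ 2 / 2)) ≤ s * m s * Real.exp (-(s ^ 2 / 2)) :=
      mul_le_mul_of_nonneg_right (by simpa [hm, plaqNorm] using hle) hpos.le
    nlinarith
  have h0 : ψ 0 = 1 := by simp [hψ, hm, plaqNorm_zero]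
  have hle : ψ θ ≤ ψ 0 := hanti (Set.mem_Ici.2 le_rfl) (Set.mem_Ici.2 hθ) hθ
  rw [h0] at hle
  have hpos : 0 < Real.exp (-(θ ^ 2 / 2)) := Real.exp_pos _
  calc plaqNorm ρ θ = ψ θ * Real.exp (θ ^ 2 / 2) := by
        simp only [hψ, hm]
        rw [mul_assoc, ← Real.exp_add, neg_add_cancel, Real.exp_zero, mul_one]
    _ ≤ 1 * Real.exp (θ ^ 2 / 2) := mul_le_mul_of_nonneg_right hle (Real.exp_pos _).le
    _ = Real.exp (θ ^ 2 / 2) := one_mul _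

/-- `m(-θ) = m(θ)` by the central element `-1 ∈ U(N)`. [folklore] -/
theorem plaqNorm_neg (hρ : IsUnitaryModel ρ) (θ : ℝ) :
    plaqNorm ρ (-θ) (G := G) = plaqNorm ρ θ (G := G) := by
  obtain ⟨z, hz, -⟩ := hρ.exists_central ρ
  unfold plaqNorm
  have h := integral_mul_left_eq_self (μ := haarProbability G)
    (fun g => Real.exp (θ * (ρ g).trace.re)) z
  rw [← h]
  refine integral_congr_ae (ae_of_all _ fun g => ?_)
  simp only [trace_re_central_mul ρ hz, mul_neg, neg_mul]

/-- **Sub-Gaussian concentration of `Re Tr` on `U(N)`, uniformly in `N`** (Chatterjee 2007,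
Thm. 8; Meckes 2019, §5.2): for `G = U(N)` and every real `θ`,
`∫_G exp(θ Re Tr ρ(g)) dg ≤ exp(θ²/2)`. [folklore] -/
theorem plaqNorm_le_exp_sq_half (hρ : IsUnitaryModel ρ) (θ : ℝ) :
    plaqNorm ρ θ (G := G) ≤ Real.exp (θ ^ 2 / 2) := by
  rcases le_total 0 θ with hθ | hθ
  · exact plaqNorm_le_exp_sq_half_of_nonneg ρ hρ hθ
  · rw [← plaqNorm_neg ρ hρ θ]
    have := plaqNorm_le_exp_sq_half_of_nonneg ρ hρ (neg_nonneg.2 hθ)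
    rwa [neg_sq] at this

/-! ## Moments of the plaquette activity `e^{β f} - 1` -/

/-- Pointwise bound: for `0 ≤ β ≤ 1`,
`|e^{β y} - 1|^K ≤ β^K K! (e^{(K+1) y} + e^{-(K+1) y})`. [folklore] -/
theorem pow_abs_exp_sub_one_le (K : ℕ) {β : ℝ} (hβ0 : 0 ≤ β) (hβ1 : β ≤ 1) (y : ℝ) :
    |Real.exp (β * y) - 1| ^ K ≤
      β ^ K * K.factorial * (Real.exp ((K + 1) * y) + Real.exp (-((K + 1) * y))) := by
  -- `|e^x - 1| ≤ |x| e^{|x|}` (cf. `BombieriSieve.abs_exp_sub_one_le`)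
  have h0 : ∀ x : ℝ, |Real.exp x - 1| ≤ |x| * Real.exp |x| := by
    intro x
    rcases le_total 0 x with hx | hx
    · rw [abs_of_nonneg hx, abs_of_nonneg (by linarith [Real.one_le_exp hx])]
      exact AreaLaw.exp_sub_one_le_mul_exp x
    · rw [abs_of_nonpos hx, abs_of_nonpos (by linarith [Real.exp_le_one_iff.2 hx])]
      have h1 : 1 - Real.exp x ≤ -x := by linarith [Real.add_one_le_exp x]
      have h2 : -x ≤ -x * Real.exp (-x) := by
        have := Real.one_le_exp (neg_nonneg.2 hx)
        nlinarith
      linarith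
  have h1 : |Real.exp (β * y) - 1| ≤ β * |y| * Real.exp |y| := by
    calc |Real.exp (β * y) - 1| ≤ |β * y| * Real.exp |β * y| := h0 _
      _ = β * |y| * Real.exp (β * |y|) := by rw [abs_mul, abs_of_nonneg hβ0]
      _ ≤ β * |y| * Real.exp |y| := by
          refine mul_le_mul_of_nonneg_left (Real.exp_le_exp.2 ?_) (by positivity)
          calc β * |y| ≤ 1 * |y| := mul_le_mul_of_nonneg_right hβ1 (abs_nonneg _)
            _ = |y| := one_mul _
  have h2 : |Real.exp (β * y) - 1| ^ K ≤ (β * |y| * Real.exp |y|) ^ K :=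
    pow_le_pow_left₀ (abs_nonneg _) h1 K
  have h3 : |y| ^ K ≤ K.factorial * Real.exp |y| := by
    have := Real.pow_div_factorial_le_exp |y| (abs_nonneg y) K
    rw [div_le_iff₀ (by positivity)] at this
    linarith
  have h4 : Real.exp |y| ^ K * Real.exp |y| = Real.exp ((K + 1) * |y|) := by
    rw [← Real.exp_nat_mul, ← Real.exp_add]; ring_nf
  have h5 : Real.exp ((K + 1) * |y|) ≤ Real.exp ((K + 1) * y) + Real.exp (-((K + 1) * y)) := by
    rcases le_total 0 y with hy | hy
    · rw [abs_of_nonneg hy]; linarith [Real.exp_pos (-((K + 1) * y))]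
    · rw [abs_of_nonpos hy, mul_neg]; linarith [Real.exp_pos (((K : ℝ) + 1) * y)]
  calc |Real.exp (β * y) - 1| ^ K ≤ (β * |y| * Real.exp |y|) ^ K := h2
    _ = β ^ K * |y| ^ K * Real.exp |y| ^ K := by rw [mul_pow, mul_pow]
    _ ≤ β ^ K * (K.factorial * Real.exp |y|) * Real.exp |y| ^ K := by
        gcongr
    _ = β ^ K * K.factorial * Real.exp ((K + 1) * |y|) := by rw [← h4]; ring
    _ ≤ β ^ K * K.factorial * (Real.exp ((K + 1) * y) + Real.exp (-((K + 1) * y))) := by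
        gcongr

/-- **Moments of the `U(N)` plaquette activity, uniformly in `N`.** For `G = U(N)`, `K ∈ ℕ` and
`0 ≤ β ≤ 1`: `∫_G |exp(β Re Tr ρ) - 1|^K dg ≤ 2 K! e^{(K+1)²/2} β^K`. [folklore] -/
theorem integral_pow_abs_exp_sub_one_le (hρ : IsUnitaryModel ρ) (K : ℕ) {β : ℝ} (hβ0 : 0 ≤ β)
    (hβ1 : β ≤ 1) :
    ∫ g, |Real.exp (β * (ρ g).trace.re) - 1| ^ K ∂haarProbability G ≤
      2 * K.factorial * Real.exp (((K : ℝ) + 1) ^ 2 / 2) * β ^ K := by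
  set μ := haarProbability G
  have hρc : Continuous ρ := hρ.1
  set f : G → ℝ := fun g => (ρ g).trace.re with hf
  have hfc : Continuous f := continuous_trace_re ρ hρc
  have hlhs : Continuous fun g => |Real.exp (β * f g) - 1| ^ K :=
    ((Real.continuous_exp.comp (continuous_const.mul hfc)).sub continuous_const).abs.pow K
  have hrhs : Continuous fun g => β ^ K * K.factorial *
      (Real.exp ((K + 1) * f g) + Real.exp (-((K + 1) * f g))) :=
    continuous_const.mul ((Real.continuous_exp.comp (continuous_const.mul hfc)).add
      (Real.continuous_exp.comp (continuous_const.mul hfc).neg))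
  have hm1 := plaqNorm_le_exp_sq_half ρ hρ ((K : ℝ) + 1)
  have hm2 := plaqNorm_le_exp_sq_half ρ hρ (-((K : ℝ) + 1))
  rw [neg_sq] at hm2
  have he1 : Integrable (fun g => Real.exp ((K + 1) * f g)) μ :=
    integrable_haar_of_continuous (Real.continuous_exp.comp (continuous_const.mul hfc))
  have he2 : Integrable (fun g => Real.exp (-((K + 1) * f g))) μ :=
    integrable_haar_of_continuous (Real.continuous_exp.comp (continuous_const.mul hfc).neg)
  calc ∫ g, |Real.exp (β * f g) - 1| ^ K ∂μ
      ≤ ∫ g, β ^ K * K.factorial * (Real.exp ((K + 1) * f g) + Real.exp (-((K + 1) * f g))) ∂μ :=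
        integral_mono (integrable_haar_of_continuous hlhs) (integrable_haar_of_continuous hrhs)
          fun g => pow_abs_exp_sub_one_le K hβ0 hβ1 (f g)
    _ = β ^ K * K.factorial * (plaqNorm ρ ((K : ℝ) + 1) (G := G) + plaqNorm ρ (-((K : ℝ) + 1)) (G := G)) := by
        rw [integral_const_mul, integral_add he1 he2]
        simp only [plaqNorm, neg_mul, hf]
        rfl
    _ ≤ β ^ K * K.factorial * (Real.exp (((K : ℝ) + 1) ^ 2 / 2) + Real.exp (((K : ℝ) + 1) ^ 2 / 2)) := by
        gcongr
    _ = 2 * K.factorial * Real.exp (((K : ℝ) + 1) ^ 2 / 2) * β ^ K := by ring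

end SubGaussian

end

end Literature.MathematicalPhysics.QuantumFieldTheory
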